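import Mathlib
import Literature.Analysis.UnboundedOperators.DiagonalSemigroupCalculus
import HarnessLib

/-!
# The exponential sandwich with a zero-mean part, MOMENT form (no sup bounds): `1 − ∫|X₂| ≤ ∫e^{X₁+X₂} ≤ 1 + ∫|X₂| + ∫(X₁+X₂)²e^{|X₁+X₂|}`
# (tool for the second-order DIAGONAL analysis of the rate twin «ratepack-v3 / frozen fibres»; route `FlatTubeReduction`, crux K1 `NearFlatRatioLaw` stmt-QuantumFields-24720;
# seat `ym-line-ftr-p1` g12; R2b1 RECORD rung — no summit statement is proved here)

WHY (memo `Cruxes/NearFlatRatioLaw/Lines/ratepack-v3-frozen-g12.md` §5.4).  RED lane A's (L3) diagonal comparison `fpBOKernel_diag_two_sided` uses the SUP form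
(`integral_exp_sandwich_of_integral_eq_zero`: `|X₁| ≤ ε₁`, `|X₂| ≤ ε₂` pointwise); sups over a fibre support of radius `β^{-1/2}log β` make the two-sidedness constant `κ_W` of the
exact dressing `W² = ⟨e^{X_u}⟩_{ρ₁}` grow like `log⁴β`, which is fatal at the rate twin's core exponent `s = 1/6` (`κ_Wδ₁² ≤ Aλ_b` with `A` FIXED).  The moment form below needs only
`∫|X₂|`, `∫X²e^{|X|}` against the reference density — Gaussian MOMENTS, which carry no logarithm:
* ★ `integral_exp_moment_sandwich` — on a probability space, `∫X₁ = 0` ⇒ `1 − ∫|X₂| ≤ ∫e^{X₁+X₂} ≤ 1 + ∫|X₂| + ∫(X₁+X₂)²e^{|X₁+X₂|}`;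
* `integral_sq_mul_exp_abs_le` — AM–GM form of the last term: `∫X²e^{|X|} ≤ (1/2t)∫X⁴ + (t/2)∫e^{2|X|}` (any `t > 0`; optimise for Cauchy–Schwarz).
HONEST FRAMING: elementary real analysis; femto rung R2b1 (RECORD label); not infinite volume, not a gap, not Clay.  No defs, no named facts, no `sorry`.
-/

set_option autoImplicit false

noncomputable section

open MeasureTheory Real

namespace Summit.QuantumFields.YangMills.Theorems.FemtoTransferGap.RateTube

/-! ## §1 ★ The moment sandwich on a probability space (the pointwise bound `|e^x − 1 − x| ≤ x²e^{|x|}` is the tree's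
`Literature.Analysis.UnboundedOperators.abs_exp_sub_one_sub_le_sq_mul_exp_abs`) -/



/-- ★ **MOMENT SANDWICH.**  On a probability space, for `X₁, X₂` with `X₁, X₂, e^{X₁+X₂}, (X₁+X₂)²e^{|X₁+X₂|}` integrable and `∫X₁ = 0`:
`1 − ∫|X₂| ≤ ∫e^{X₁+X₂} ≤ 1 + ∫|X₂| + ∫(X₁+X₂)²e^{|X₁+X₂|}`. [folklore] -/
theorem integral_exp_moment_sandwich {C : Type*} [MeasurableSpace C] (ν : Measure C) [IsProbabilityMeasure ν] {X₁ X₂ : C → ℝ}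
    (hi1 : Integrable X₁ ν) (hi2 : Integrable X₂ ν)
    (hiexp : Integrable (fun c => Real.exp (X₁ c + X₂ c)) ν) (hiR : Integrable (fun c => (X₁ c + X₂ c) ^ 2 * Real.exp |X₁ c + X₂ c|) ν)
    (hmean : ∫ c, X₁ c ∂ν = 0) :
    1 - ∫ c, |X₂ c| ∂ν ≤ ∫ c, Real.exp (X₁ c + X₂ c) ∂ν ∧
      ∫ c, Real.exp (X₁ c + X₂ c) ∂ν ≤ 1 + ∫ c, |X₂ c| ∂ν + ∫ c, (X₁ c + X₂ c) ^ 2 * Real.exp |X₁ c + X₂ c| ∂ν := by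
  have hi12 : Integrable (fun c => X₁ c + X₂ c) ν := hi1.add hi2
  have hiabs : Integrable (fun c => |X₂ c|) ν := hi2.abs
  have hI2 : |∫ c, X₂ c ∂ν| ≤ ∫ c, |X₂ c| ∂ν := abs_integral_le_integral_abs
  have hsum : ∫ c, (X₁ c + X₂ c) ∂ν = ∫ c, X₂ c ∂ν := by rw [integral_add hi1 hi2, hmean, zero_add]
  constructor
  · -- lower: `e^x ≥ 1 + x`
    have hpt : ∀ c, 1 + (X₁ c + X₂ c) ≤ Real.exp (X₁ c + X₂ c) := fun c => by linarith [Real.add_one_le_exp (X₁ c + X₂ c)]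
    have h := integral_mono (f := fun c => 1 + (X₁ c + X₂ c)) (g := fun c => Real.exp (X₁ c + X₂ c)) ((integrable_const (1 : ℝ)).add hi12) hiexp hpt
    have e : ∫ c, (1 + (X₁ c + X₂ c)) ∂ν = 1 + ∫ c, X₂ c ∂ν := by
      rw [integral_add (integrable_const _) hi12, hsum]; simp
    rw [e] at h
    linarith [(abs_le.mp hI2).1]
  · -- upper: `e^x ≤ 1 + x + x²e^{|x|}`
    have hpt : ∀ c, Real.exp (X₁ c + X₂ c) ≤ 1 + (X₁ c + X₂ c) + (X₁ c + X₂ c) ^ 2 * Real.exp |X₁ c + X₂ c| := fun c => by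
      have h := (abs_le.mp (Literature.Analysis.UnboundedOperators.abs_exp_sub_one_sub_le_sq_mul_exp_abs (X₁ c + X₂ c))).2
      linarith
    have h := integral_mono (f := fun c => Real.exp (X₁ c + X₂ c)) (g := fun c => 1 + (X₁ c + X₂ c) + (X₁ c + X₂ c) ^ 2 * Real.exp |X₁ c + X₂ c|) hiexp
      (((integrable_const (1 : ℝ)).add hi12).add hiR) hpt
    have hi1s : Integrable (fun c => 1 + (X₁ c + X₂ c)) ν := (integrable_const (1 : ℝ)).add hi12
    have e : ∫ c, (1 + (X₁ c + X₂ c) + (X₁ c + X₂ c) ^ 2 * Real.exp |X₁ c + X₂ c|) ∂ν =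
        1 + ∫ c, X₂ c ∂ν + ∫ c, (X₁ c + X₂ c) ^ 2 * Real.exp |X₁ c + X₂ c| ∂ν := by
      rw [integral_add hi1s hiR, integral_add (integrable_const _) hi12, hsum]; simp
    rw [e] at h
    linarith [(abs_le.mp hI2).2]

/-- **AM–GM for the remainder**: for every `t > 0`, `∫X²e^{|X|} ≤ (1/(2t))∫X⁴ + (t/2)∫e^{2|X|}` (optimising `t` gives Cauchy–Schwarz).  No integrability of the left side is
assumed: if `X²e^{|X|}` is not integrable its Bochner integral is `0` and the (nonnegative) right side still dominates — so read it as a moment bound only when the left side is a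
genuine integral. [folklore] -/
theorem integral_sq_mul_exp_abs_le {C : Type*} [MeasurableSpace C] (ν : Measure C) {X : C → ℝ} {t : ℝ} (ht : 0 < t)
    (hi4 : Integrable (fun c => X c ^ 4) ν) (hiE : Integrable (fun c => Real.exp (2 * |X c|)) ν) :
    ∫ c, X c ^ 2 * Real.exp |X c| ∂ν ≤ 1 / (2 * t) * ∫ c, X c ^ 4 ∂ν + t / 2 * ∫ c, Real.exp (2 * |X c|) ∂ν := by
  have hpt : ∀ c, X c ^ 2 * Real.exp |X c| ≤ 1 / (2 * t) * X c ^ 4 + t / 2 * Real.exp (2 * |X c|) := fun c => by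
    have e : Real.exp (2 * |X c|) = Real.exp |X c| ^ 2 := by rw [sq, ← Real.exp_add]; ring_nf
    rw [e]
    have h0 : 0 ≤ (X c ^ 2 - t * Real.exp |X c|) ^ 2 := sq_nonneg _
    have h1 : X c ^ 2 * Real.exp |X c| * (2 * t) ≤ X c ^ 4 + t ^ 2 * Real.exp |X c| ^ 2 := by nlinarith [h0]
    have h2 : X c ^ 2 * Real.exp |X c| ≤ (X c ^ 4 + t ^ 2 * Real.exp |X c| ^ 2) / (2 * t) := by rw [le_div_iff₀ (by positivity)]; exact h1
    have e2 : (X c ^ 4 + t ^ 2 * Real.exp |X c| ^ 2) / (2 * t) = 1 / (2 * t) * X c ^ 4 + t / 2 * Real.exp |X c| ^ 2 := by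
      field_simp
    linarith [h2, e2]
  by_cases hint : Integrable (fun c => X c ^ 2 * Real.exp |X c|) ν
  · calc ∫ c, X c ^ 2 * Real.exp |X c| ∂ν ≤ ∫ c, (1 / (2 * t) * X c ^ 4 + t / 2 * Real.exp (2 * |X c|)) ∂ν :=
          integral_mono hint ((hi4.const_mul _).add (hiE.const_mul _)) hpt
      _ = 1 / (2 * t) * ∫ c, X c ^ 4 ∂ν + t / 2 * ∫ c, Real.exp (2 * |X c|) ∂ν := by
          rw [integral_add (hi4.const_mul _) (hiE.const_mul _), integral_const_mul, integral_const_mul]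
  · rw [integral_undef hint]
    have h1 : 0 ≤ ∫ c, X c ^ 4 ∂ν := integral_nonneg fun c => by positivity
    have h2 : 0 ≤ ∫ c, Real.exp (2 * |X c|) ∂ν := integral_nonneg fun c => (Real.exp_pos _).le
    positivity

end Summit.QuantumFields.YangMills.Theorems.FemtoTransferGap.RateTube

end
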